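import Summits.HodgeConjecture.HodgeConjecture.Theorems.F0P3TowerGlueClassMap
import Summits.HodgeConjecture.HodgeConjecture.Theorems.F0P3S1Plan
import Summits.HodgeConjecture.HodgeConjecture.Theorems.H413TowerHodgeDecomposition
import Summits.HodgeConjecture.HodgeConjecture.Theorems.P4StubT2cCohClassMapOfHol
import Summits.HodgeConjecture.HodgeCM.Model.TowerAlgebra
import Literature.RepresentationTheory.Semisimple.EquivariantIrreducibleDecomposition
import HarnessLib

/-!
# FLOOR-0 P3 ∕ P4 — THE ONE THEOREM: the Matsushima–Hodge class map `cohForms 𝔞₀ → H¹_{B,τ'}(A_∞, ℂ)` is an equivariant BIJECTION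
# (whence S1 a second time, through ★ `F0P3S1Plan.stubS1_of_cls_bijective` — recorded as an `example`, the statement being ★ `F0P3StubS1Dec.stubS1_holds`)

Cell hodgecm-mathlib (D-0151), FLOOR 0, crux item H413 = stmt-HodgeConjecture-24833; programmes P3 (line `F0_U3CohMultOne`, stub S1) and P4 (line
`F0_P4AdmissibleOccursInH1`, node T2 = T2a + T2b + T2c).  Author F0P3-p01 (g0).  `--supports stmt-HodgeConjecture-24833 --as helper`.  Theorems only.
The JOIN-BRIEF of the P3 lead (F0P3-plan (g0), §3 p01): «ONE theorem — `cls : cohForms 𝔞₀ → H¹_B` is a `G_f`-equivariant BIJECTION ⇒ `dec := cls⁻¹`».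

* §1 `exists_cohClassMap_bijective_of_hol` — A-p08 (g15)'s generic extension ★ `exists_cohClassMap_of_hol` (`cls (a + conj a′) := cls₁₀ a + cB (cls₁₀ a′)`,
  Mathlib `LinearMap.ofIsCompl` over ★ `isCompl_holCotForms_map_conjFun`) UPGRADED TO A BIJECTION under two more hypotheses: `cls₁₀` maps ONTO `P`
  and `H = P + cB P`;
* §2 `exists_cohClassMap_bijective` — the instance: `cls₁₀ := clsHol` (A-p13 (g21), ★ injective equivariant), `P := H10T`, `cB := conjT`, ONTO by this
  seat's ★ `H10T_le_range_clsHol` (inverse gluing), disjointness ★ `eq_zero_of_mem_H10T_of_conjT_eq`, and the Hodge decomposition OF THE TOWER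
  `H = H^{1,0} + conj H^{1,0}` = A-p19 (g15)'s ★ `TowerConj.exists_H10T_add_conjT` (`Theorems/H413TowerHodgeDecomposition`): an injective,
  SURJECTIVE, `act`-equivariant `cls : cohForms (archFactorOf F V) →ₗ[ℂ] Tower … V`;
* §3 AT THE PIN: `t2Bijective_pin` — P4's `StubT2MatsushimaHodgeAt` with `Injective` strengthened to `Bijective` (`rhoB τ' = act`); the term
  `F0P3S1Plan.stubS1_of_cls_bijective t2Bijective_pin` is then a second proof of S1 (kernel-checked `example`; the statement itself is the landed
  ★ `F0P3StubS1Dec.stubS1_holds` (p792863), whose road is the direct limit `H413TowerRealisation.realT`; same gluing underneath).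

HC_CM is proved only modulo the printed citations until rung 0 closes; this file proves nothing about them.
[cite: BorelWallach2000, VII 2.10, VII 3.2, VII 3.6, XIII 1.2] [cite: VoisinHodgeI2002, §6.1.3 Cor. 6.12; §7.1.1 Cor. 7.6] [cite: Liu2021, proof of Prop. 4.13, l. 2121–2131]

## References
* [BorelWallach2000] A. Borel, N. Wallach, 2nd ed., AMS 2000, VII 2.10 (Hodge bigrading), 3.2 and 3.6 (Matsushima), XIII 1.2 (adelic pieces).
* [VoisinHodgeI2002] C. Voisin, *Hodge Theory I*, CUP 2002, §6.1.3 Cor. 6.12 (`H¹ = H^{1,0} ⊕ \overline{H^{1,0}}`), §7.1.1 Cor. 7.6.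
* [Liu2021] Y. Liu, Camb. J. Math. 9 (2021), proof of Prop. 4.13, l. 2121–2131 (the Matsushima step).
* Tree: ★ `Theorems/F0P3TowerGlueClassMap` ∕ `F0P3TowerGlue` ∕ `F0P3S1Plan` ∕ `F0P3StubS1Dec` (this seat), ★ `Theorems/H413TowerHodgeDecomposition` ∕
  `H413TowerConj` (A-p19), ★ `Theorems/H413CuspCotClassMap` ∕ `…Pin` (A-p13), ★ `Theorems/P4StubT2cCohClassMapOfHol` (A-p08: `exists_holPart`, `exists_antiholPart`).
-/

set_option autoImplicit false
set_option linter.dupNamespace false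

noncomputable section

open NumberField NumberField.InfinitePlace
open Literature.AlgebraicGeometry.ShimuraVarieties Literature.AlgebraicGeometry.HodgeTheory
open Literature.NumberTheory.Automorphic Literature.NumberTheory.Automorphic.PicardCM
open Literature.NumberTheory.Transcendental (Arapura2012_Cor_15_4_6)
open HodgeCM HodgeCM.Model HodgeCM.Model.LiuIndex HodgeCM.Model.TowerLevel HodgeCM.Model.TowerCarrier
open Summit.HodgeConjecture.CorCM.Model
open Literature.AlgebraicGeometry.Motives (CMType)
open Literature.AlgebraicGeometry.ShimuraVarieties.UnitaryCanonicalModel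
open Literature.NumberTheory.ComplexMultiplication
open Literature.NumberTheory.Automorphic.Liu2021 Literature.NumberTheory.Automorphic.Liu2021.AppendixC
open Literature.NumberTheory.GelbartRogawski1991
open Summit.HodgeConjecture.CorCM Summit.HodgeConjecture.CorCM.Transposition
open Summit.HodgeConjecture.CorCM.Lines.A3Liu413 (datum413)
open Summit.HodgeConjecture.HodgeConjecture.Cruxes.H413.CohFormsCarriers
open Summit.HodgeConjecture.HodgeConjecture.Cruxes.H413.TowerConj
open Summit.HodgeConjecture.HodgeConjecture.Cruxes.H413.P4StubT2cCohClassMapOfHol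

namespace Summit.HodgeConjecture.HodgeConjecture.Cruxes.H413.CuspCot

variable {F : HodgeCM.CMField} {ι₁ : F →+* ℂ} {V : HodgeCM.HermSpace3 F ι₁}

/-! ## §1 Generic: the extension by conjugation is a BIJECTION when `cls₁₀` is onto `P` and `H = P + cB P` -/

/-- **Bijective extension of a holomorphic class map by conjugation** (A-p08's ★ `exists_cohClassMap_of_hol` plus surjectivity): with `cls₁₀`
injective, equivariant, ONTO the subspace `P`, `cB` injective conjugate-linear commuting with `ρ`, `P ∩ cB P = 0` and `H = P + cB P`, the map
`cls (a + conj a′) := cls₁₀ a + cB (cls₁₀ a′)` is an equivariant linear BIJECTION `cohForms 𝔞₀ → H`. [cite: BorelWallach2000, VII 2.10 and 3.6] -/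
theorem exists_cohClassMap_bijective_of_hol (H : Type) [AddCommGroup H] [Module ℂ H]
    (ρ : Representation ℂ ↥(HodgeCM.HermSpace3.adelicFin V) H) (P : Submodule ℂ H)
    (cls₁₀ : ↥(holCotForms (archFactorOf F V)) →ₗ[ℂ] H) (hinj : Function.Injective cls₁₀)
    (hequiv : ∀ (g : ↥(HodgeCM.HermSpace3.adelicFin V)) (f : ↥(holCotForms (archFactorOf F V)))
        (hgf : rightRep F V g (f : _) ∈ holCotForms (archFactorOf F V)),
        cls₁₀ ⟨rightRep F V g (f : _), hgf⟩ = ρ g (cls₁₀ f))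
    (hP : ∀ f : ↥(holCotForms (archFactorOf F V)), cls₁₀ f ∈ P)
    (hPsurj : ∀ x ∈ P, ∃ f : ↥(holCotForms (archFactorOf F V)), cls₁₀ f = x)
    (cB : H →ₛₗ[starRingEnd ℂ] H) (hcB : Function.Injective cB)
    (hcBρ : ∀ (g : ↥(HodgeCM.HermSpace3.adelicFin V)) (x : H), cB (ρ g x) = ρ g (cB x))
    (hdisj : ∀ x y : H, x ∈ P → y ∈ P → cB y = x → x = 0)
    (hsum : ∀ x : H, ∃ p q : H, p ∈ P ∧ q ∈ P ∧ x = p + cB q) :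
    ∃ cls : ↥(cohForms (archFactorOf F V)) →ₗ[ℂ] H,
      Function.Bijective cls ∧
        ∀ (g : ↥(HodgeCM.HermSpace3.adelicFin V)) (f : ↥(cohForms (archFactorOf F V)))
          (hgf : rightRep F V g (f : _) ∈ cohForms (archFactorOf F V)),
          cls ⟨rightRep F V g (f : _), hgf⟩ = ρ g (cls f) := by
  have h𝔞 : (archFactorOf F V).IsHonest := P4StubT1ArchFactor.archFactorOf_isHonest F V
  have hc := isCompl_holCotForms_map_conjFun (archFactorOf F V)
  obtain ⟨φ, hφ⟩ := exists_holPart (archFactorOf F V) cls₁₀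
  obtain ⟨ψ, hψ⟩ := exists_antiholPart (archFactorOf F V) cls₁₀ cB
  -- the value of the extension on `a + conj a₂`
  have key : ∀ (a : (adelicDatum F V).Adelic → (Fin 2 → ℂ)) (ha : a ∈ holCotForms (archFactorOf F V))
      (a₂ : (adelicDatum F V).Adelic → (Fin 2 → ℂ)) (ha₂ : a₂ ∈ holCotForms (archFactorOf F V))
      (h : a + conjFun F V a₂ ∈ cohForms (archFactorOf F V)),
      LinearMap.ofIsCompl hc φ ψ ⟨a + conjFun F V a₂, h⟩ = cls₁₀ ⟨a, ha⟩ + cB (cls₁₀ ⟨a₂, ha₂⟩) := by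
    intro a ha a₂ ha₂ h
    have ha' : a ∈ cohForms (archFactorOf F V) := holCotForms_le_cohForms (archFactorOf F V) ha
    have hb' : conjFun F V a₂ ∈ cohForms (archFactorOf F V) := conjFun_mem_cohForms_of_mem_holCotForms ha₂
    have hu : (⟨a, ha'⟩ : ↥(cohForms (archFactorOf F V))) ∈ (holCotForms (archFactorOf F V)).comap (cohForms (archFactorOf F V)).subtype := ha
    have hv : (⟨conjFun F V a₂, hb'⟩ : ↥(cohForms (archFactorOf F V))) ∈
        ((holCotForms (archFactorOf F V)).map (conjFun F V)).comap (cohForms (archFactorOf F V)).subtype :=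
      Submodule.mem_map_of_mem ha₂
    have hsplit : (⟨a + conjFun F V a₂, h⟩ : ↥(cohForms (archFactorOf F V))) =
        ((⟨⟨a, ha'⟩, hu⟩ : ↥((holCotForms (archFactorOf F V)).comap (cohForms (archFactorOf F V)).subtype)) : ↥(cohForms (archFactorOf F V))) +
          ((⟨⟨conjFun F V a₂, hb'⟩, hv⟩ : ↥(((holCotForms (archFactorOf F V)).map (conjFun F V)).comap (cohForms (archFactorOf F V)).subtype)) :
            ↥(cohForms (archFactorOf F V))) :=
      Subtype.ext rfl
    rw [hsplit, map_add, LinearMap.ofIsCompl_apply_left, LinearMap.ofIsCompl_apply_right, hφ, hψ]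
    have hcc : (⟨conjFun F V (conjFun F V a₂), conjFun_mem_holCotForms_of_mem_map hv⟩ : ↥(holCotForms (archFactorOf F V))) =
        ⟨a₂, ha₂⟩ := Subtype.ext (conjFun_conjFun F V a₂)
    exact congrArg (fun z => cls₁₀ ⟨a, ha⟩ + cB (cls₁₀ z)) hcc
  refine ⟨LinearMap.ofIsCompl hc φ ψ, ⟨?_, ?_⟩, ?_⟩
  · -- injectivity
    rw [← LinearMap.ker_eq_bot, Submodule.eq_bot_iff]
    rintro ⟨f, hf⟩ hf0
    rw [LinearMap.mem_ker] at hf0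
    obtain ⟨a, ha, b, hb, hab⟩ := Submodule.mem_sup.1 hf
    obtain ⟨a₂, ha₂, rfl⟩ := Submodule.mem_map.1 hb
    have h : (⟨f, hf⟩ : ↥(cohForms (archFactorOf F V))) = ⟨a + conjFun F V a₂, hab.symm ▸ hf⟩ := Subtype.ext hab.symm
    rw [h, key a ha a₂ ha₂] at hf0
    have h1 : cB (cls₁₀ ⟨-a₂, Submodule.neg_mem _ ha₂⟩) = cls₁₀ ⟨a, ha⟩ := by
      have hneg : (⟨-a₂, Submodule.neg_mem _ ha₂⟩ : ↥(holCotForms (archFactorOf F V))) = -⟨a₂, ha₂⟩ := rfl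
      rw [hneg, map_neg, map_neg, eq_comm, eq_neg_iff_add_eq_zero]
      exact hf0
    have h2 : cls₁₀ ⟨a, ha⟩ = 0 := hdisj _ _ (hP _) (hP _) h1
    have ha0 : a = 0 := congrArg Subtype.val (hinj (h2.trans (map_zero cls₁₀).symm))
    have h3 : cB (cls₁₀ ⟨a₂, ha₂⟩) = 0 := by
      rw [h2, zero_add] at hf0
      exact hf0
    have ha₂0 : a₂ = 0 := by
      have h4 : cls₁₀ ⟨a₂, ha₂⟩ = 0 := hcB (h3.trans (map_zero cB).symm)
      exact congrArg Subtype.val (hinj (h4.trans (map_zero cls₁₀).symm))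
    apply Subtype.ext
    show f = 0
    rw [← hab, ha0, ha₂0, map_zero, add_zero]
  · -- surjectivity: `x = p + cB q`, `p = cls₁₀ f`, `q = cls₁₀ f'` ⇒ `x = cls (f + conj f')`
    intro x
    obtain ⟨p, q, hp, hq, rfl⟩ := hsum x
    obtain ⟨⟨a, ha⟩, rfl⟩ := hPsurj p hp
    obtain ⟨⟨a₂, ha₂⟩, rfl⟩ := hPsurj q hq
    refine ⟨⟨a + conjFun F V a₂, Submodule.add_mem _ (holCotForms_le_cohForms (archFactorOf F V) ha)
      (conjFun_mem_cohForms_of_mem_holCotForms ha₂)⟩, key a ha a₂ ha₂ _⟩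
  · -- equivariance
    rintro g ⟨f, hf⟩ hgf
    obtain ⟨a, ha, b, hb, hab⟩ := Submodule.mem_sup.1 hf
    obtain ⟨a₂, ha₂, rfl⟩ := Submodule.mem_map.1 hb
    have hga : rightRep F V g a ∈ holCotForms (archFactorOf F V) := h𝔞.rightRep_mem_holCotForms ha g
    have hga₂ : rightRep F V g a₂ ∈ holCotForms (archFactorOf F V) := h𝔞.rightRep_mem_holCotForms ha₂ g
    have hsum' : rightRep F V g f = rightRep F V g a + conjFun F V (rightRep F V g a₂) := by
      rw [← hab, map_add, conjFun_rightRep]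
    have h : (⟨f, hf⟩ : ↥(cohForms (archFactorOf F V))) = ⟨a + conjFun F V a₂, hab.symm ▸ hf⟩ := Subtype.ext hab.symm
    have h' : (⟨rightRep F V g f, hgf⟩ : ↥(cohForms (archFactorOf F V))) =
        ⟨rightRep F V g a + conjFun F V (rightRep F V g a₂), hsum' ▸ hgf⟩ := Subtype.ext hsum'
    rw [h', key _ hga _ hga₂, h, key a ha a₂ ha₂, map_add, hequiv g ⟨a, ha⟩ hga, hequiv g ⟨a₂, ha₂⟩ hga₂, hcBρ]

/-! ## §2 The bijective equivariant class map `cohForms 𝔞₀ → H` (records-generic, anisotropic regime) -/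

section Records

variable (hHD : exists_isReal_hodgeModel) (hI : hodgePQ_independent_of_hodgeModel)
  (h₁ : BallQuotientUniformised) (h₃ : CMAbelianVarietyRealised) (hA : Arapura2012_Cor_15_4_6)
  (hV : IsAnisotropic F (HodgeCM.HermSpace3.Hm V))

include hV in
/-- **THE MATSUSHIMA–HODGE CLASS MAP IS AN EQUIVARIANT BIJECTION `cohForms (archFactorOf F V) ≅ H = colim_K H¹(X_K(ℂ); ℂ)`** (`cls₁₀ := clsHol`,
`P := H10T`, `cB := conjT`; onto by ★ `H10T_le_range_clsHol` and ★ `TowerConj.exists_H10T_add_conjT`). [cite: BorelWallach2000, VII 3.2, VII 3.6, XIII 1.2]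
[cite: VoisinHodgeI2002, §7.1.1 Cor. 7.6] -/
theorem exists_cohClassMap_bijective :
    ∃ cls : ↥(cohForms (archFactorOf F V)) →ₗ[ℂ] Tower hHD hI (ballQuotientUniformisedDatum_of h₁) h₃ hA V,
      Function.Bijective cls ∧
        ∀ (g : ↥(HodgeCM.HermSpace3.adelicFin V)) (f : ↥(cohForms (archFactorOf F V)))
          (hgf : rightRep F V g (f : _) ∈ cohForms (archFactorOf F V)),
          cls ⟨rightRep F V g (f : _), hgf⟩ = act hHD hI (ballQuotientUniformisedDatum_of h₁) h₃ hA g (cls f) :=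
  exists_cohClassMap_bijective_of_hol _ (towerRep hHD hI (ballQuotientUniformisedDatum_of h₁) h₃ hA V)
    (H10T hHD hI (ballQuotientUniformisedDatum_of h₁) h₃ hA V) (clsHol hHD hI h₁ h₃ hA hV) (clsHol_injective hHD hI h₁ h₃ hA hV)
    (fun g f hgf => clsHol_rightRep hHD hI h₁ h₃ hA hV g f hgf)
    (fun f => clsHol_mem_hodge10Part F V hV hHD hI h₁ h₃ hA f)
    (fun _ hx => H10T_le_range_clsHol hHD hI h₁ h₃ hA hV hx)
    (conjT hHD hI (ballQuotientUniformisedDatum_of h₁) h₃ hA V) (conjT_injective hHD hI (ballQuotientUniformisedDatum_of h₁) h₃ hA)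
    (fun g x => conjT_act hHD hI (ballQuotientUniformisedDatum_of h₁) h₃ hA g x)
    (fun _ _ hx hy hyx => eq_zero_of_mem_H10T_of_conjT_eq hHD hI (ballQuotientUniformisedDatum_of h₁) h₃ hA hx hy hyx)
    (exists_H10T_add_conjT hHD hI (ballQuotientUniformisedDatum_of h₁) h₃ hA V)

end Records

/-! ## §3 At the pin: P4-T2 with `Bijective`, and S1 a second time -/

set_option synthInstance.maxHeartbeats 400000 in
set_option maxHeartbeats 8000000 in
/-- **P4's `StubT2MatsushimaHodgeAt` with `Injective cls` strengthened to `Bijective cls`** (the hypothesis of ★ `F0P3S1Plan.stubS1_of_cls_bijective`),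
at the records of record (`4 ≤ [F:ℚ]` ⇒ anisotropic; `rhoB τ' = Representation.ofModule'` acts by `act`). [cite: BorelWallach2000, VII 3.2, XIII 1.2] -/
theorem t2Bijective_pin :
    ∀ (hDel : Literature.AlgebraicGeometry.ShimuraVarieties.UnitaryCanonicalModel.canonicalModel_exists_printed)
      (F : HodgeCM.CMField) [IsGalois ℚ F] (h6 : 6 ≤ Module.finrank ℚ F) {ι₁ : F →+* ℂ} (V : HodgeCM.HermSpace3 F ι₁) (a₀ : RealScalar F)
      (Φ : CMType F) (hΦ : ι₁ ∈ Φ.1) (i : (I V (repAt a₀) (muLiu ι₁ GramClass.rep))),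
      3 ≤ (datum413 hDel F V a₀ Φ i).n → ∀ τ' : HodgeCM.CMField.K F →+* ℂ,
        ∃ cls : ↥(cohForms (archFactorOf F V)) →ₗ[ℂ] (datum413 hDel F V a₀ Φ i).HB τ',
          Function.Bijective cls ∧
            ∀ (g : ↥(HodgeCM.HermSpace3.adelicFin V)) (f : ↥(cohForms (archFactorOf F V)))
              (hgf : rightRep F V g (f : _) ∈ cohForms (archFactorOf F V)),
              cls ⟨rightRep F V g (f : _), hgf⟩ = (datum413 hDel F V a₀ Φ i).rhoB τ' g (cls f) := by
  intro hDel F _ h6 ι₁ V a₀ Φ _ i _ τ'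
  have h4 : 4 ≤ Module.finrank ℚ F := le_trans (by norm_num) h6
  have hV : IsAnisotropic F (HodgeCM.HermSpace3.Hm V) := HodgeCM.HermSpace3.isAnisotropic V h4
  obtain ⟨cls, hbij, heqv⟩ := exists_cohClassMap_bijective exists_isReal_hodgeModel_holds hodgePQ_independent_of_hodgeModel_holds
    Summit.HodgeConjecture.CorCM.BallQuotient.ballQuotientUniformised_holds
    (cmAbelianVarietyRealised_of_eigenbasis exists_isReal_hodgeModel_holds hodgePQ_independent_of_hodgeModel_holds
      Summit.HodgeConjecture.CorCM.cmAbelianVarietyEigenbasisRealised_holds)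
    Literature.NumberTheory.Transcendental.arapura2012_cor_15_4_6_holds hV
  refine ⟨cls, hbij, fun g f hgf => ?_⟩
  have h2 : ∀ z : Tower exists_isReal_hodgeModel_holds hodgePQ_independent_of_hodgeModel_holds
      (ballQuotientUniformisedDatum_of Summit.HodgeConjecture.CorCM.BallQuotient.ballQuotientUniformised_holds)
      (cmAbelianVarietyRealised_of_eigenbasis exists_isReal_hodgeModel_holds hodgePQ_independent_of_hodgeModel_holds
        Summit.HodgeConjecture.CorCM.cmAbelianVarietyEigenbasisRealised_holds)
      Literature.NumberTheory.Transcendental.arapura2012_cor_15_4_6_holds V,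
      Representation.ofModule' (k := ℂ) (G := ↥(HodgeCM.HermSpace3.adelicFin V)) _ g z =
        act exists_isReal_hodgeModel_holds hodgePQ_independent_of_hodgeModel_holds
          (ballQuotientUniformisedDatum_of Summit.HodgeConjecture.CorCM.BallQuotient.ballQuotientUniformised_holds)
          (cmAbelianVarietyRealised_of_eigenbasis exists_isReal_hodgeModel_holds hodgePQ_independent_of_hodgeModel_holds
            Summit.HodgeConjecture.CorCM.cmAbelianVarietyEigenbasisRealised_holds)
          Literature.NumberTheory.Transcendental.arapura2012_cor_15_4_6_holds g z := fun z =>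
    (Literature.RepresentationTheory.Semisimple.ofModule'_apply_eq_of_smul (k := ℂ) (G := ↥(HodgeCM.HermSpace3.adelicFin V)) _ g z).trans
      (of_smul_eq_act _ _ _ _ _ g z)
  exact (heqv g f hgf).trans (h2 (cls f)).symm

/- NOTE (dedup): `F0P3S1Plan.stubS1_of_cls_bijective t2Bijective_pin` is a term of the type of ★ `F0P3StubS1Dec.stubS1_holds` (the body of
`StubS1HodgeMatsushimaDecAt`), i.e. a second proof of S1 through the bijection; it is NOT re-declared here (the statement is landed, p792863). -/
set_option synthInstance.maxHeartbeats 400000 in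
set_option maxHeartbeats 8000000 in
example := F0P3S1Plan.stubS1_of_cls_bijective t2Bijective_pin

end Summit.HodgeConjecture.HodgeConjecture.Cruxes.H413.CuspCot

end
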